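import Mathlib
import Summits.NavierStokesRegularity.NavierStokesRegularity.Theorems.EulerZoomLiouvillePowerGaugeEulerLiouvilleHelicityCutoff
import Summits.NavierStokesRegularity.NavierStokesRegularity.Theorems.EulerZoomLiouvillePowerGaugeEulerLiouvilleAxisymNoSwirlScaling
import Literature.Analysis.FluidPDE.ClassicalSolutionGlue
import Literature.Analysis.FluidPDE.MildSolutionProofs
import HarnessLib

/-!
# ZERO HELICITY of discretely self-similar Euler collapse — a necessary condition valid AT THE NATURAL TAIL
# (helper for the crux `EulerZoomLiouville.PowerGaugeEulerLiouville`, route №10, item stmt-NavierStokesRegularity-19832)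

Helper file (theorems only; `--supports stmt-NavierStokesRegularity-19832`). Seat ns-typeII-p3 (cell
ns-regularity-ideate §B, D-0081). Sequel of `…HelicityCutoff.lean`.

(1) CONSERVATION OF HELICITY WITHOUT RAPID DECAY (`helicity_eq_of_classical`): for a classical Euler flow
`(u, p)` on `(−∞, 0)` and `s < t < 0` such that on `[s, t]` the helicity density `⟪u, ω⟫` is integrable
and the flux density `F = (|p| + ½|u|²)|ω| + (‖∇u‖ |u| + ‖∇p‖)|u|` has `∫F ≤ N`, one has
`∫⟪u(t), ω(t)⟫ = ∫⟪u(s), ω(s)⟫` (cut-off balance of the prequel, the flux through the shell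
`R < |y| < 2R` being `O(N/R)`; the tree's `euler_helicity_conservation_holds` needs Schwartz decay).
(2) SCALING (`integral_helicity_smul_comp_smul`): under the class scaling `u ↦ l^{1+ρ}u(l·)` the helicity
is multiplied by `l^{2ρ}` (`⟪u, ω⟫` scales by `l^{3+2ρ}`, volume by `l⁻³`).
(3) Hence (`helicity_eq_zero_of_dss`): **every classical DSS member of the class scaling with `ρ > 0`,
`l > 1`, and the above integrability on compact time intervals has ZERO HELICITY on every slice** —
`H(τ) = H(l^{2+ρ}τ) = l^{2ρ} H(τ)`. Unlike the energy (`ρ ≠ 1/2` only), the vorticity `L^q` levers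
(`q < 3/(2+ρ)`) and the support lever, this constraint is NOT critical at the natural tail of self-similar
Euler collapse: for `|u| ~ |y|^{−(1+ρ)}`, `|ω| ~ |y|^{−(2+ρ)}`, `|p| ~ |y|^{−2(1+ρ)}` all the densities above
are integrable at infinity (`⟪u,ω⟫ ~ |y|^{−(3+2ρ)}`, `F ~ |y|^{−(4+3ρ)}`). It is a TEST every candidate
refuting profile of the window must pass (cf. the CIV 2026 constraints in the route's KILL TEST), not an
exclusion. In print: conservation of helicity is Moreau 1961 / Moffatt 1969 (Majda–Bertozzi Prop. 1.12);
its incompatibility with the self-similar scalings `α ≠ N/2` is the remark of Chae–Shvydkoy,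
ARMA 209 (2013) p. 3 («α = N/2 is the only scaling consistent with the energy conservation for globally
self-similar solutions if the helicity is not zero», citing Chae and Schonbek); the DSS form for Seregin's
gauged class (α = 1+ρ, every ρ > 0), under natural-tail integrability only, is [folklore].

WHAT THIS IS NOT: not NS, not the crux, not a Liouville theorem — a necessary condition (`H ≡ 0`) for the
members of the open core of rung C2/C1. [folklore]
-/

noncomputable section

-- the summit and its single problem share the name `NavierStokesRegularity` (D-0017 nested layout)
set_option linter.dupNamespace false

open Set Function Filter Topology MeasureTheory Metric Module
open scoped NNReal ENNReal InnerProductSpace RealInnerProductSpace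

namespace Summit.NavierStokesRegularity.NavierStokesRegularity.Theorems.PowerGaugeEulerLiouville.Helicity

open Literature.Analysis Literature.Analysis.FluidPDE
open Summit.NavierStokesRegularity.NavierStokesRegularity.Theorems.PowerGaugeEulerLiouville.AxisymNoSwirl

section Conservation

variable {T : ℝ} {v : ℝ → (EuclideanSpace ℝ (Fin 3)) → (EuclideanSpace ℝ (Fin 3))}
  {p : ℝ → (EuclideanSpace ℝ (Fin 3)) → ℝ}

/-- **Conservation of helicity on `[0, T]` under integrable flux densities.** [folklore] -/
theorem helicity_eq_of_Icc (hT : 0 < T) (hv : IsClassicalNSSolutionOn (Icc 0 T) 0 0 v p)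
    (hI1 : ∀ σ ∈ Icc 0 T, Integrable (fun x => ⟪v σ x, curl (v σ) x⟫)) {N : ℝ}
    (hI2 : ∀ σ ∈ Icc 0 T, Integrable (fun x => (|p σ x| + ‖v σ x‖ ^ 2 / 2) * ‖curl (v σ) x‖ +
        (‖fderiv ℝ (v σ) x‖ * ‖v σ x‖ + ‖gradient (p σ) x‖) * ‖v σ x‖) ∧
      ∫ x, ((|p σ x| + ‖v σ x‖ ^ 2 / 2) * ‖curl (v σ) x‖ +
        (‖fderiv ℝ (v σ) x‖ * ‖v σ x‖ + ‖gradient (p σ) x‖) * ‖v σ x‖) ≤ N) :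
    ∫ x, ⟪v T x, curl (v T) x⟫ = ∫ x, ⟪v 0 x, curl (v 0) x⟫ := by
  have hTm : T ∈ Icc 0 T := ⟨hT.le, le_rfl⟩
  have h0m : (0 : ℝ) ∈ Icc 0 T := ⟨le_rfl, hT.le⟩
  obtain ⟨C, hC0, hC⟩ := exists_norm_fderiv_cutoff_le (E := (EuclideanSpace ℝ (Fin 3)))
  have hN0 : 0 ≤ N := by
    refine le_trans (integral_nonneg fun x => ?_) (hI2 0 h0m).2
    positivity
  -- pointwise bound of `∂ₜv` from the Euler equation
  have hdt : ∀ σ ∈ Icc 0 T, ∀ x, ‖FluidPDE.timeDerivWithin (Icc 0 T) v σ x‖ ≤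
      ‖fderiv ℝ (v σ) x‖ * ‖v σ x‖ + ‖gradient (p σ) x‖ := by
    intro σ hσ x
    have h := hv.momentum σ hσ x
    simp only [zero_smul, Pi.zero_apply, add_zero, zero_sub, convect_apply] at h
    have e : FluidPDE.timeDerivWithin (Icc 0 T) v σ x = -gradient (p σ) x - fderiv ℝ (v σ) x (v σ x) :=
      eq_sub_of_add_eq h
    rw [e]
    calc ‖-gradient (p σ) x - fderiv ℝ (v σ) x (v σ x)‖ ≤ ‖-gradient (p σ) x‖ + ‖fderiv ℝ (v σ) x (v σ x)‖ :=
          norm_sub_le _ _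
      _ ≤ ‖gradient (p σ) x‖ + ‖fderiv ℝ (v σ) x‖ * ‖v σ x‖ := by
          rw [norm_neg]; exact add_le_add le_rfl ((fderiv ℝ (v σ) x).le_opNorm _)
      _ = _ := by ring
  -- the flux bound at radius `R`
  have hflux : ∀ {R : ℝ}, 0 < R → ∀ σ ∈ Icc 0 T,
      |2 * (∫ x, (p σ x + ‖v σ x‖ ^ 2 / 2) * fderiv ℝ (cutoff R) x (curl (v σ) x)) +
        ∫ x, ⟪FluidPDE.timeDerivWithin (Icc 0 T) v σ x,
          curlCLM ((fderiv ℝ (cutoff R) x).smulRight (v σ x))⟫| ≤ (2 + ‖curlCLM‖) * (C / R) * N := by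
    intro R hR σ hσ
    have hCR : 0 ≤ C / R := div_nonneg hC0 hR.le
    -- first flux piece
    have h1 : |∫ x, (p σ x + ‖v σ x‖ ^ 2 / 2) * fderiv ℝ (cutoff R) x (curl (v σ) x)| ≤ C / R * N := by
      have hpt : ∀ x, ‖(p σ x + ‖v σ x‖ ^ 2 / 2) * fderiv ℝ (cutoff R) x (curl (v σ) x)‖ ≤
          C / R * ((|p σ x| + ‖v σ x‖ ^ 2 / 2) * ‖curl (v σ) x‖ +
            (‖fderiv ℝ (v σ) x‖ * ‖v σ x‖ + ‖gradient (p σ) x‖) * ‖v σ x‖) := by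
        intro x
        rw [norm_mul, Real.norm_eq_abs, Real.norm_eq_abs]
        have ha : |p σ x + ‖v σ x‖ ^ 2 / 2| ≤ |p σ x| + ‖v σ x‖ ^ 2 / 2 := by
          refine (abs_add_le _ _).trans (add_le_add le_rfl (le_of_eq (abs_of_nonneg (by positivity))))
        have hb : |fderiv ℝ (cutoff R) x (curl (v σ) x)| ≤ C / R * ‖curl (v σ) x‖ := by
          rw [← Real.norm_eq_abs]
          exact ((fderiv ℝ (cutoff R) x).le_opNorm _).trans (mul_le_mul_of_nonneg_right (hC R hR x) (norm_nonneg _))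
        have hrest : 0 ≤ (‖fderiv ℝ (v σ) x‖ * ‖v σ x‖ + ‖gradient (p σ) x‖) * ‖v σ x‖ := by positivity
        calc |p σ x + ‖v σ x‖ ^ 2 / 2| * |fderiv ℝ (cutoff R) x (curl (v σ) x)|
            ≤ (|p σ x| + ‖v σ x‖ ^ 2 / 2) * (C / R * ‖curl (v σ) x‖) :=
              mul_le_mul ha hb (abs_nonneg _) (by positivity)
          _ = C / R * ((|p σ x| + ‖v σ x‖ ^ 2 / 2) * ‖curl (v σ) x‖) := by ring
          _ ≤ _ := by gcongr; linarith
      have h := norm_integral_le_of_norm_le ((hI2 σ hσ).1.const_mul (C / R)) (Eventually.of_forall hpt)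
      rw [Real.norm_eq_abs, integral_const_mul] at h
      exact h.trans (mul_le_mul_of_nonneg_left (hI2 σ hσ).2 hCR)
    -- second flux piece
    have h2 : |∫ x, ⟪FluidPDE.timeDerivWithin (Icc 0 T) v σ x,
        curlCLM ((fderiv ℝ (cutoff R) x).smulRight (v σ x))⟫| ≤ ‖curlCLM‖ * (C / R) * N := by
      have hpt : ∀ x, ‖⟪FluidPDE.timeDerivWithin (Icc 0 T) v σ x,
          curlCLM ((fderiv ℝ (cutoff R) x).smulRight (v σ x))⟫‖ ≤
          ‖curlCLM‖ * (C / R) * ((|p σ x| + ‖v σ x‖ ^ 2 / 2) * ‖curl (v σ) x‖ +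
            (‖fderiv ℝ (v σ) x‖ * ‖v σ x‖ + ‖gradient (p σ) x‖) * ‖v σ x‖) := by
        intro x
        have hK : ‖curlCLM ((fderiv ℝ (cutoff R) x).smulRight (v σ x))‖ ≤ ‖curlCLM‖ * (C / R * ‖v σ x‖) := by
          refine (curlCLM.le_opNorm _).trans (mul_le_mul_of_nonneg_left ?_ (norm_nonneg _))
          rw [ContinuousLinearMap.norm_smulRight_apply]
          exact mul_le_mul_of_nonneg_right (hC R hR x) (norm_nonneg _)
        have hfirst : 0 ≤ (|p σ x| + ‖v σ x‖ ^ 2 / 2) * ‖curl (v σ) x‖ := by positivity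
        calc ‖⟪FluidPDE.timeDerivWithin (Icc 0 T) v σ x, curlCLM ((fderiv ℝ (cutoff R) x).smulRight (v σ x))⟫‖
            ≤ ‖FluidPDE.timeDerivWithin (Icc 0 T) v σ x‖ *
                ‖curlCLM ((fderiv ℝ (cutoff R) x).smulRight (v σ x))‖ := norm_inner_le_norm _ _
          _ ≤ (‖fderiv ℝ (v σ) x‖ * ‖v σ x‖ + ‖gradient (p σ) x‖) * (‖curlCLM‖ * (C / R * ‖v σ x‖)) :=
              mul_le_mul (hdt σ hσ x) hK (norm_nonneg _) (by positivity)
          _ = ‖curlCLM‖ * (C / R) * ((‖fderiv ℝ (v σ) x‖ * ‖v σ x‖ + ‖gradient (p σ) x‖) * ‖v σ x‖) := by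
              ring
          _ ≤ _ := by gcongr; linarith
      have h := norm_integral_le_of_norm_le ((hI2 σ hσ).1.const_mul (‖curlCLM‖ * (C / R)))
        (Eventually.of_forall hpt)
      rw [Real.norm_eq_abs, integral_const_mul] at h
      exact h.trans (mul_le_mul_of_nonneg_left (hI2 σ hσ).2 (by positivity))
    calc _ ≤ |2 * (∫ x, (p σ x + ‖v σ x‖ ^ 2 / 2) * fderiv ℝ (cutoff R) x (curl (v σ) x))| +
          |∫ x, ⟪FluidPDE.timeDerivWithin (Icc 0 T) v σ x,
            curlCLM ((fderiv ℝ (cutoff R) x).smulRight (v σ x))⟫| := abs_add_le _ _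
      _ ≤ 2 * (C / R * N) + ‖curlCLM‖ * (C / R) * N := by
          rw [abs_mul, abs_of_pos (by norm_num : (0 : ℝ) < 2)]
          exact add_le_add (mul_le_mul_of_nonneg_left h1 (by norm_num)) h2
      _ = (2 + ‖curlCLM‖) * (C / R) * N := by ring
  -- the balance at radius `n + 1` and its bound
  have hbd : ∀ n : ℕ, |(∫ x, cutoff ((n : ℝ) + 1) x * ⟪v T x, curl (v T) x⟫) -
      (∫ x, cutoff ((n : ℝ) + 1) x * ⟪v 0 x, curl (v 0) x⟫)| ≤
      (2 + ‖curlCLM‖) * (C / ((n : ℝ) + 1)) * N * T := by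
    intro n
    have hR : (0 : ℝ) < (n : ℝ) + 1 := by positivity
    rw [integral_weight_helicity_sub_eq hT hv (contDiff_cutoff _) (hasCompactSupport_cutoff hR)]
    have h := norm_setIntegral_le_of_norm_le_const (μ := volume) (s := Ioo 0 T)
      (C := (2 + ‖curlCLM‖) * (C / ((n : ℝ) + 1)) * N) (by simp)
      (fun σ hσ => by rw [Real.norm_eq_abs]; exact hflux hR σ (Ioo_subset_Icc_self hσ))
    have hvol : volume.real (Ioo 0 T) = T := by rw [Real.volume_real_Ioo_of_le hT.le, sub_zero]
    simpa only [Real.norm_eq_abs, hvol] using h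
  -- the limits `n → ∞`
  have hlim : Tendsto (fun n : ℕ => (∫ x, cutoff ((n : ℝ) + 1) x * ⟪v T x, curl (v T) x⟫) -
      (∫ x, cutoff ((n : ℝ) + 1) x * ⟪v 0 x, curl (v 0) x⟫)) atTop
      (𝓝 ((∫ x, ⟪v T x, curl (v T) x⟫) - ∫ x, ⟪v 0 x, curl (v 0) x⟫)) :=
    (tendsto_integral_cutoff_mul (hI1 T hTm)).sub (tendsto_integral_cutoff_mul (hI1 0 h0m))
  have hbound : Tendsto (fun n : ℕ => (2 + ‖curlCLM‖) * (C / ((n : ℝ) + 1)) * N * T) atTop (𝓝 0) := by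
    have h1 : Tendsto (fun n : ℕ => C / ((n : ℝ) + 1)) atTop (𝓝 0) :=
      tendsto_const_nhds.div_atTop (tendsto_natCast_atTop_atTop.atTop_add tendsto_const_nhds)
    simpa using ((h1.const_mul (2 + ‖curlCLM‖)).mul_const N).mul_const T
  have hzero : Tendsto (fun n : ℕ => (∫ x, cutoff ((n : ℝ) + 1) x * ⟪v T x, curl (v T) x⟫) -
      (∫ x, cutoff ((n : ℝ) + 1) x * ⟪v 0 x, curl (v 0) x⟫)) atTop (𝓝 0) :=
    squeeze_zero_norm (fun n => by rw [Real.norm_eq_abs]; exact hbd n) hbound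
  have heq := tendsto_nhds_unique hlim hzero
  linarith

/-- **Conservation of helicity along a classical Euler flow on `(−∞, 0)`** under integrable helicity
and flux densities on `[s, t]` (no rapid decay). [folklore] -/
theorem helicity_eq_of_classical
    {u : ℝ → (EuclideanSpace ℝ (Fin 3)) → (EuclideanSpace ℝ (Fin 3))} {p : ℝ → (EuclideanSpace ℝ (Fin 3)) → ℝ}
    (hns : IsClassicalNSSolutionOn (Iio 0) 0 0 u p) {s t : ℝ} (hst : s < t) (ht : t < 0)
    (hI1 : ∀ τ ∈ Icc s t, Integrable (fun x => ⟪u τ x, curl (u τ) x⟫)) {N : ℝ}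
    (hI2 : ∀ τ ∈ Icc s t, Integrable (fun x => (|p τ x| + ‖u τ x‖ ^ 2 / 2) * ‖curl (u τ) x‖ +
        (‖fderiv ℝ (u τ) x‖ * ‖u τ x‖ + ‖gradient (p τ) x‖) * ‖u τ x‖) ∧
      ∫ x, ((|p τ x| + ‖u τ x‖ ^ 2 / 2) * ‖curl (u τ) x‖ +
        (‖fderiv ℝ (u τ) x‖ * ‖u τ x‖ + ‖gradient (p τ) x‖) * ‖u τ x‖) ≤ N) :
    ∫ x, ⟪u t x, curl (u t) x⟫ = ∫ x, ⟪u s x, curl (u s) x⟫ := by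
  set T : ℝ := t - s with hTdef
  have hT : 0 < T := sub_pos.2 hst
  have hsub : Icc 0 T ⊆ (fun σ : ℝ => σ + s) ⁻¹' Iio (0 : ℝ) := by
    intro σ hσ; show σ + s < 0; have := hσ.2; rw [hTdef] at this; linarith
  have hmem : ∀ σ ∈ Icc 0 T, σ + s ∈ Icc s t := fun σ hσ =>
    ⟨by linarith [hσ.1], by have := hσ.2; rw [hTdef] at this; linarith⟩
  have hv : IsClassicalNSSolutionOn (Icc 0 T) 0 0 (fun σ => u (σ + s)) (fun σ => p (σ + s)) :=
    (hns.comp_add_right s).mono hsub (uniqueDiffOn_Icc hT)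
  have h := helicity_eq_of_Icc hT hv (fun σ hσ => hI1 (σ + s) (hmem σ hσ)) (fun σ hσ => hI2 (σ + s) (hmem σ hσ))
  simp only [hTdef, sub_add_cancel, zero_add] at h
  exact h

end Conservation

/-! ## Scaling of the helicity and the DSS constraint -/

/-- **Helicity under the class scaling**: `∫⟪w, curl w⟫ = c² λ⁻¹ ∫⟪v, curl v⟫` for `w = c • v(λ ·)`,
`λ > 0`, `v` differentiable. [folklore] -/
theorem integral_helicity_smul_comp_smul {v : (EuclideanSpace ℝ (Fin 3)) → (EuclideanSpace ℝ (Fin 3))}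
    (hv : Differentiable ℝ v) (c : ℝ) {lam : ℝ} (hlam : 0 < lam) :
    ∫ y, ⟪c • v (lam • y), curl (fun z : (EuclideanSpace ℝ (Fin 3)) => c • v (lam • z)) y⟫ =
      c ^ 2 * lam * (lam ^ 3)⁻¹ * ∫ y, ⟪v y, curl v y⟫ := by
  have hpt : ∀ y, ⟪c • v (lam • y), curl (fun z : (EuclideanSpace ℝ (Fin 3)) => c • v (lam • z)) y⟫ =
      (c ^ 2 * lam) * (fun z => ⟪v z, curl v z⟫) (lam • y) := by
    intro y
    rw [curl_smul_comp_smul hv c lam y, inner_smul_left, inner_smul_right]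
    simp only [conj_trivial]
    ring
  rw [integral_congr_ae (Eventually.of_forall hpt), integral_const_mul,
    Measure.integral_comp_smul volume (fun z : (EuclideanSpace ℝ (Fin 3)) => ⟪v z, curl v z⟫) lam,
    finrank_euclideanSpace_fin, abs_of_pos (inv_pos.2 (pow_pos hlam 3)), smul_eq_mul]
  ring

/-- **DSS Euler collapse has zero helicity.** For a classical Euler flow on `(−∞, 0)` that is discretely
self-similar for the class scaling with `ρ > 0`, `l > 1` (`u(τ,y) = l^{1+ρ}u(l^{2+ρ}τ, l y)`), with
integrable helicity density and integrable flux density `(|p| + ½|u|²)|ω| + (‖∇u‖|u| + ‖∇p‖)|u|` bounded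
on compact time intervals, the helicity `∫⟪u(τ), curl u(τ)⟫` vanishes at every `τ < 0`
(`H(l^{2+ρ}τ) = H(τ)` by conservation and `= l^{−2ρ}H(τ)` by scaling). [folklore] -/
theorem helicity_eq_zero_of_dss {ρ : ℝ} (hρ : 0 < ρ)
    {u : ℝ → (EuclideanSpace ℝ (Fin 3)) → (EuclideanSpace ℝ (Fin 3))} {p : ℝ → (EuclideanSpace ℝ (Fin 3)) → ℝ}
    (hns : IsClassicalNSSolutionOn (Iio 0) 0 0 u p) {l : ℝ} (hl : 1 < l)
    (hdss : ∀ τ : ℝ, τ < 0 → ∀ y, u τ y = (l ^ (1 + ρ)) • u ((l ^ (2 + ρ)) * τ) (l • y))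
    (hint : ∀ s t : ℝ, s < t → t < 0 → ∃ N : ℝ, ∀ τ ∈ Icc s t,
      Integrable (fun x => ⟪u τ x, curl (u τ) x⟫) ∧
      Integrable (fun x => (|p τ x| + ‖u τ x‖ ^ 2 / 2) * ‖curl (u τ) x‖ +
        (‖fderiv ℝ (u τ) x‖ * ‖u τ x‖ + ‖gradient (p τ) x‖) * ‖u τ x‖) ∧
      ∫ x, ((|p τ x| + ‖u τ x‖ ^ 2 / 2) * ‖curl (u τ) x‖ +
        (‖fderiv ℝ (u τ) x‖ * ‖u τ x‖ + ‖gradient (p τ) x‖) * ‖u τ x‖) ≤ N)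
    {τ : ℝ} (hτ : τ < 0) : ∫ y, ⟪u τ y, curl (u τ) y⟫ = 0 := by
  have hl0 : 0 < l := zero_lt_one.trans hl
  have hL : 1 < l ^ (2 + ρ) := Real.one_lt_rpow hl (by linarith)
  set τ' : ℝ := l ^ (2 + ρ) * τ with hτ'
  have hτ'τ : τ' < τ := by
    have : τ' - τ = (l ^ (2 + ρ) - 1) * τ := by rw [hτ']; ring
    nlinarith
  have hτ'0 : τ' < 0 := hτ'τ.trans hτ
  -- conservation between `τ'` and `τ`
  obtain ⟨N, hN⟩ := hint τ' τ hτ'τ hτ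
  have hcons := helicity_eq_of_classical hns hτ'τ hτ (fun σ hσ => (hN σ hσ).1) (fun σ hσ => (hN σ hσ).2)
  -- scaling between `τ` and `τ'`
  have hfun : u τ = fun y => (l ^ (1 + ρ)) • u τ' (l • y) := funext fun y => hdss τ hτ y
  have hd : Differentiable ℝ (u τ') := (hns.contDiff_velocity hτ'0).differentiable (by simp)
  have hscal : ∫ y, ⟪u τ y, curl (u τ) y⟫ = (l ^ (1 + ρ)) ^ 2 * l * (l ^ 3)⁻¹ * ∫ y, ⟪u τ' y, curl (u τ') y⟫ := by
    rw [hfun]; exact integral_helicity_smul_comp_smul hd _ hl0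
  -- the factor is `l^{2ρ} ≠ 1`
  have hfac : (l ^ (1 + ρ)) ^ 2 * l * (l ^ 3)⁻¹ = l ^ (2 * ρ) := by
    rw [← Real.rpow_natCast (l ^ (1 + ρ)) 2, ← Real.rpow_mul hl0.le, ← Real.rpow_natCast l 3,
      ← Real.rpow_neg hl0.le, ← Real.rpow_add_one hl0.ne', ← Real.rpow_add hl0]
    congr 1; push_cast; ring
  have hfac1 : 1 < l ^ (2 * ρ) := Real.one_lt_rpow hl (by linarith)
  rw [hfac] at hscal
  rw [hcons] at hscal
  -- `H(τ') = l^{2ρ} H(τ')` ⇒ `H(τ') = 0` ⇒ `H(τ) = 0`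
  have hzero : ∫ y, ⟪u τ' y, curl (u τ') y⟫ = 0 := by
    have : (l ^ (2 * ρ) - 1) * ∫ y, ⟪u τ' y, curl (u τ') y⟫ = 0 := by linarith
    rcases mul_eq_zero.1 this with h | h
    · linarith
    · exact h
  rw [hcons, hzero]

end Summit.NavierStokesRegularity.NavierStokesRegularity.Theorems.PowerGaugeEulerLiouville.Helicity

end
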